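import Mathlib
import HarnessLib
import HarnessLib.Audit
import Summits.Parity.Statement
import Literature.Barriers.Parity.SiegelZeroDichotomy
import Literature.NumberTheory.Sieve.HardyLittlewood
import Literature.Barriers.Parity.LogarithmicAveraging

/-!
Route: ScaleTauberianCarving

DORMANT since 2026-09-04T15:40:16Z (reconciler: no traction for 5 d (last activity statement-checked at 2026-08-30T14:16:36Z); parked, not closed — `ledger route dormant route-Parity-ScaleTauberianCarving --off` to reactivate) — unstaffed, not closed; items shared with open routes are served there. `ledger route dormant <id> --off` reactivates.

# Route ScaleTauberianCarving — GHL ⟸ the record's Siegel/uniform leaves ∧ log-window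
Hardy–Littlewood ∧ two-scale rigidity (scale-Tauberian carving of the fixed leaves; conforming
resurrection of X6)

decomp-parity (D-0178/D-0179) lens-6 g6 node «ScaleTauberianCarving» (RESIDUAL mode, BLOCKER FIRST;
NODE HOME/STATUS.md l.311, re-issue l.313):
an ALTERNATIVE DECOMPOSITION of the record route route-Parity-SiegelSpectrumSplit beneath its two
FIXED-PATTERN leaves FU = stmt-Parity-26852 and
FL = stmt-Parity-26863 jointly, along the SCALE axis. It suffices to show X = Q ∧
UniformUpperGivenFixed ∧ UniformLowerGivenFixed ∧ LogWindowHL ∧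
ScaleRigidity ∧ UpperGlue ∧ LowerGlue, where Q (25148), UniformUpperGivenFixed (26853),
UniformLowerGivenFixed (26864) are the record's items VERBATIM
(shared by signature); LogWindowHL := for every fixed non-degenerate system the Hardy–Littlewood
asymptotic holds on LOGARITHMIC AVERAGE over every
scale window (N, M], M ≥ N², uniformly over convex bodies transported by dilation K ↦ (n/N)•K;
ScaleRigidity := the normalised signed error
err/N^d moves by at most ε along every dilation chain across the matched scale window [N, N²]
(two-scale rigidity, the R-form — the
declared residual; the stronger spelling «the density EXISTS», uniform Cauchy in all n ≥ N, is
equivalent to it modulo LogWindowHL); UpperGlue /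
LowerGlue := LogWindowHL → ScaleRigidity → FixedUpper / FixedLower (support: closed by the cell
kernel). Kernel (HOME/decomp-parity-lens-6/g6/
ScaleTauberianCarving.lean, rc 0, 0 sorry): leaf_iff : (FixedUpper ∧ FixedLower) ↔ (LogWindowHL ∧
ScaleRigidity), HYPOTHESIS-FREE and pattern-local
(fixedAt_iff, for each system separately); closes with 7/7 binders through the record's uniform
items; node_iff modulo the record's GHL ⟹ Q.
Lean: `(∃ η₀ : ℝ, ∃ q₀ : ℕ, ∀ (q : ℕ) [NeZero q] (χ : DirichletCharacter ℂ q) (η : ℝ), q₀ ≤ q →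
Literature.Barriers.Parity.IsSiegelZero χ η → η < η₀) ∧ ((∃ η₀ : ℝ, ∃ q₀ : ℕ, ∀ (q : ℕ) [NeZero q]
(χ : DirichletCharacter ℂ q) (η : ℝ), q₀ ≤ q → Literature.Barriers.Parity.IsSiegelZero χ η → η < η₀)
→ (∀ (d t : ℕ), 1 ≤ d → 1 ≤ t → ∀ Ψ : Fin t → Literature.NumberTheory.Sieve.AffLinForm d,
Literature.NumberTheory.Sieve.IsNondegenerateSystem Ψ → ∀ ε : ℝ, 0 < ε → ∃ N₀ : ℕ, ∀ N : ℕ, N₀ ≤ N →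
∀ K : Set (Fin d → ℝ), Convex ℝ K → K ⊆ Literature.NumberTheory.Sieve.realBox d N →
Literature.NumberTheory.Sieve.vonMangoldtSum Ψ K N - Literature.NumberTheory.Sieve.archFactor Ψ K *
Literature.NumberTheory.Sieve.singularProduct Ψ ≤ ε * (N : ℝ) ^ d) → ∀ (d t L : ℕ), 1 ≤ d → 1 ≤ t →
∀ ε : ℝ, 0 < ε → ∃ N₀ : ℕ, ∀ N : ℕ, N₀ ≤ N → ∀ Ψ : Fin t → Literature.NumberTheory.Sieve.AffLinForm
d, Literature.NumberTheory.Sieve.IsNondegenerateSystem Ψ → Literature.NumberTheory.Sieve.affLinSize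
Ψ N ≤ L → ∀ K : Set (Fin d → ℝ), Convex ℝ K → K ⊆ Literature.NumberTheory.Sieve.realBox d N →
Literature.NumberTheory.Sieve.vonMangoldtSum Ψ K N - Literature.NumberTheory.Sieve.archFactor Ψ K *
Literature.NumberTheory.Sieve.singularProduct Ψ ≤ ε * (N : ℝ) ^ d) ∧ ((∃ η₀ : ℝ, ∃ q₀ : ℕ, ∀ (q : ℕ)
[NeZero q] (χ : DirichletCharacter ℂ q) (η : ℝ), q₀ ≤ q → Literature.Barriers.Parity.IsSiegelZero χ
η → η < η₀) → (∀ (d t : ℕ), 1 ≤ d → 1 ≤ t → ∀ Ψ : Fin t → Literature.NumberTheory.Sieve.AffLinForm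
d, Literature.NumberTheory.Sieve.IsNondegenerateSystem Ψ → ∀ ε : ℝ, 0 < ε → ∃ N₀ : ℕ, ∀ N : ℕ, N₀ ≤
N → ∀ K : Set (Fin d → ℝ), Convex ℝ K → K ⊆ Literature.NumberTheory.Sieve.realBox d N →
Literature.NumberTheory.Sieve.archFactor Ψ K * Literature.NumberTheory.Sieve.singularProduct Ψ -
Literature.NumberTheory.Sieve.vonMangoldtSum Ψ K N ≤ ε * (N : ℝ) ^ d) → ∀ (d t L : ℕ), 1 ≤ d → 1 ≤ t
→ ∀ ε : ℝ, 0 < ε → ∃ N₀ : ℕ, ∀ N : ℕ, N₀ ≤ N → ∀ Ψ : Fin t →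
Literature.NumberTheory.Sieve.AffLinForm d, Literature.NumberTheory.Sieve.IsNondegenerateSystem Ψ →
Literature.NumberTheory.Sieve.affLinSize Ψ N ≤ L → ∀ K : Set (Fin d → ℝ), Convex ℝ K → K ⊆
Literature.NumberTheory.Sieve.realBox d N → Literature.NumberTheory.Sieve.archFactor Ψ K *
Literature.NumberTheory.Sieve.singularProduct Ψ - Literature.NumberTheory.Sieve.vonMangoldtSum Ψ K N
≤ ε * (N : ℝ) ^ d) ∧ (∀ (d t : ℕ), 1 ≤ d → 1 ≤ t → ∀ Ψ : Fin t →
Literature.NumberTheory.Sieve.AffLinForm d, Literature.NumberTheory.Sieve.IsNondegenerateSystem Ψ →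
∀ ε : ℝ, 0 < ε → ∃ N₀ : ℕ, ∀ N : ℕ, N₀ ≤ N → ∀ M : ℕ, N ^ 2 ≤ M → ∀ K : Set (Fin d → ℝ), Convex ℝ K
→ K ⊆ Literature.NumberTheory.Sieve.realBox d N → |∑ n ∈ Finset.Ioc N M,
(Literature.NumberTheory.Sieve.vonMangoldtSum Ψ ((fun x : Fin d → ℝ => ((n : ℝ) / (N : ℝ)) • x) ''
K) n - Literature.NumberTheory.Sieve.archFactor Ψ ((fun x : Fin d → ℝ => ((n : ℝ) / (N : ℝ)) • x) ''
K) * Literature.NumberTheory.Sieve.singularProduct Ψ) / (n : ℝ) ^ d / n| ≤ ε * ∑ n ∈ Finset.Ioc N M,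
(1 : ℝ) / n) ∧ (∀ (d t : ℕ), 1 ≤ d → 1 ≤ t → ∀ Ψ : Fin t → Literature.NumberTheory.Sieve.AffLinForm
d, Literature.NumberTheory.Sieve.IsNondegenerateSystem Ψ → ∀ ε : ℝ, 0 < ε → ∃ N₀ : ℕ, ∀ N : ℕ, N₀ ≤
N → ∀ n : ℕ, N ≤ n → n ≤ N ^ 2 → ∀ K : Set (Fin d → ℝ), Convex ℝ K → K ⊆
Literature.NumberTheory.Sieve.realBox d N → |(Literature.NumberTheory.Sieve.vonMangoldtSum Ψ K N -
Literature.NumberTheory.Sieve.archFactor Ψ K * Literature.NumberTheory.Sieve.singularProduct Ψ) / (N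
: ℝ) ^ d - (Literature.NumberTheory.Sieve.vonMangoldtSum Ψ ((fun x : Fin d → ℝ => ((n : ℝ) / (N :
ℝ)) • x) '' K) n - Literature.NumberTheory.Sieve.archFactor Ψ ((fun x : Fin d → ℝ => ((n : ℝ) / (N :
ℝ)) • x) '' K) * Literature.NumberTheory.Sieve.singularProduct Ψ) / (n : ℝ) ^ d| ≤ ε) ∧ ((∀ (d t :
ℕ), 1 ≤ d → 1 ≤ t → ∀ Ψ : Fin t → Literature.NumberTheory.Sieve.AffLinForm d,
Literature.NumberTheory.Sieve.IsNondegenerateSystem Ψ → ∀ ε : ℝ, 0 < ε → ∃ N₀ : ℕ, ∀ N : ℕ, N₀ ≤ N →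
∀ M : ℕ, N ^ 2 ≤ M → ∀ K : Set (Fin d → ℝ), Convex ℝ K → K ⊆ Literature.NumberTheory.Sieve.realBox d
N → |∑ n ∈ Finset.Ioc N M, (Literature.NumberTheory.Sieve.vonMangoldtSum Ψ ((fun x : Fin d → ℝ =>
((n : ℝ) / (N : ℝ)) • x) '' K) n - Literature.NumberTheory.Sieve.archFactor Ψ ((fun x : Fin d → ℝ =>
((n : ℝ) / (N : ℝ)) • x) '' K) * Literature.NumberTheory.Sieve.singularProduct Ψ) / (n : ℝ) ^ d / n|
≤ ε * ∑ n ∈ Finset.Ioc N M, (1 : ℝ) / n) → (∀ (d t : ℕ), 1 ≤ d → 1 ≤ t → ∀ Ψ : Fin t →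
Literature.NumberTheory.Sieve.AffLinForm d, Literature.NumberTheory.Sieve.IsNondegenerateSystem Ψ →
∀ ε : ℝ, 0 < ε → ∃ N₀ : ℕ, ∀ N : ℕ, N₀ ≤ N → ∀ n : ℕ, N ≤ n → n ≤ N ^ 2 → ∀ K : Set (Fin d → ℝ),
Convex ℝ K → K ⊆ Literature.NumberTheory.Sieve.realBox d N →
|(Literature.NumberTheory.Sieve.vonMangoldtSum Ψ K N - Literature.NumberTheory.Sieve.archFactor Ψ K
* Literature.NumberTheory.Sieve.singularProduct Ψ) / (N : ℝ) ^ d -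
(Literature.NumberTheory.Sieve.vonMangoldtSum Ψ ((fun x : Fin d → ℝ => ((n : ℝ) / (N : ℝ)) • x) ''
K) n - Literature.NumberTheory.Sieve.archFactor Ψ ((fun x : Fin d → ℝ => ((n : ℝ) / (N : ℝ)) • x) ''
K) * Literature.NumberTheory.Sieve.singularProduct Ψ) / (n : ℝ) ^ d| ≤ ε) → ∀ (d t : ℕ), 1 ≤ d → 1 ≤
t → ∀ Ψ : Fin t → Literature.NumberTheory.Sieve.AffLinForm d,
Literature.NumberTheory.Sieve.IsNondegenerateSystem Ψ → ∀ ε : ℝ, 0 < ε → ∃ N₀ : ℕ, ∀ N : ℕ, N₀ ≤ N →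
∀ K : Set (Fin d → ℝ), Convex ℝ K → K ⊆ Literature.NumberTheory.Sieve.realBox d N →
Literature.NumberTheory.Sieve.vonMangoldtSum Ψ K N - Literature.NumberTheory.Sieve.archFactor Ψ K *
Literature.NumberTheory.Sieve.singularProduct Ψ ≤ ε * (N : ℝ) ^ d) ∧ ((∀ (d t : ℕ), 1 ≤ d → 1 ≤ t →
∀ Ψ : Fin t → Literature.NumberTheory.Sieve.AffLinForm d,
Literature.NumberTheory.Sieve.IsNondegenerateSystem Ψ → ∀ ε : ℝ, 0 < ε → ∃ N₀ : ℕ, ∀ N : ℕ, N₀ ≤ N →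
∀ M : ℕ, N ^ 2 ≤ M → ∀ K : Set (Fin d → ℝ), Convex ℝ K → K ⊆ Literature.NumberTheory.Sieve.realBox d
N → |∑ n ∈ Finset.Ioc N M, (Literature.NumberTheory.Sieve.vonMangoldtSum Ψ ((fun x : Fin d → ℝ =>
((n : ℝ) / (N : ℝ)) • x) '' K) n - Literature.NumberTheory.Sieve.archFactor Ψ ((fun x : Fin d → ℝ =>
((n : ℝ) / (N : ℝ)) • x) '' K) * Literature.NumberTheory.Sieve.singularProduct Ψ) / (n : ℝ) ^ d / n|
≤ ε * ∑ n ∈ Finset.Ioc N M, (1 : ℝ) / n) → (∀ (d t : ℕ), 1 ≤ d → 1 ≤ t → ∀ Ψ : Fin t →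
Literature.NumberTheory.Sieve.AffLinForm d, Literature.NumberTheory.Sieve.IsNondegenerateSystem Ψ →
∀ ε : ℝ, 0 < ε → ∃ N₀ : ℕ, ∀ N : ℕ, N₀ ≤ N → ∀ n : ℕ, N ≤ n → n ≤ N ^ 2 → ∀ K : Set (Fin d → ℝ),
Convex ℝ K → K ⊆ Literature.NumberTheory.Sieve.realBox d N →
|(Literature.NumberTheory.Sieve.vonMangoldtSum Ψ K N - Literature.NumberTheory.Sieve.archFactor Ψ K
* Literature.NumberTheory.Sieve.singularProduct Ψ) / (N : ℝ) ^ d -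
(Literature.NumberTheory.Sieve.vonMangoldtSum Ψ ((fun x : Fin d → ℝ => ((n : ℝ) / (N : ℝ)) • x) ''
K) n - Literature.NumberTheory.Sieve.archFactor Ψ ((fun x : Fin d → ℝ => ((n : ℝ) / (N : ℝ)) • x) ''
K) * Literature.NumberTheory.Sieve.singularProduct Ψ) / (n : ℝ) ^ d| ≤ ε) → ∀ (d t : ℕ), 1 ≤ d → 1 ≤
t → ∀ Ψ : Fin t → Literature.NumberTheory.Sieve.AffLinForm d,
Literature.NumberTheory.Sieve.IsNondegenerateSystem Ψ → ∀ ε : ℝ, 0 < ε → ∃ N₀ : ℕ, ∀ N : ℕ, N₀ ≤ N →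
∀ K : Set (Fin d → ℝ), Convex ℝ K → K ⊆ Literature.NumberTheory.Sieve.realBox d N →
Literature.NumberTheory.Sieve.archFactor Ψ K * Literature.NumberTheory.Sieve.singularProduct Ψ -
Literature.NumberTheory.Sieve.vonMangoldtSum Ψ K N ≤ ε * (N : ℝ) ^ d)`

## Assembly
Pure logic plus |a − b| ≤ c ⟺ (a − b ≤ c ∧ b − a ≤ c): hUU hQ (hGU hA hB) is the uniform upper half,
hUL hQ (hGL hA hB) the uniform lower half, and
the two halves with N₀ := max give GHL (`closes` in glue.lean, 7/7 binders consumed). Exactness in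
the cell file: leaf_iff ((FixedUpper ∧ FixedLower) ↔
(LogWindowHL ∧ ScaleRigidity), kernel, hypothesis-free), fixedAt_iff (pattern-local) and node_iff
(GHL ↔ X modulo the record's necessity of Q).

Rationale: WHY THIS LINE. The tree's barrier Literature.Barriers.Parity.LogarithmicAveraging (PROVED:
LogarithmicAveraging_holds; Hall's set has log density ½ and no natural
density — hasLogDensity_hallSet, not_hasNaturalDensity_hallSet, not_logToMeanTransfer_nonneg) says
logarithmically averaged information never
transfers to natural-scale statements on classes containing the 0/1-valued sequences; its PROVED
EVASION HasLogMeanValue.eq_of_hasMeanValue says the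
transfer is automatic on the subclass whose mean value EXISTS. The lens recipe «S ⟸ A ∧ B, A outside
the barrier's hypotheses by construction, B
structural» on the scale axis gives A = the log-window Hardy–Littlewood statement (whose Liouville
sibling, log-averaged two-point Chowla, is the tree
THEOREM Literature.NumberTheory.LFunctions.tao_log_chowla_two_holds [TaoFMP2016 Thm 1.2; corpus
paper:arxiv-1509.05422 pp.3–4], while the leaf's
sibling two-point Chowla is open) and B = existence of the density («proving the mere existence of
the limit captures the difficulty»,
TaoTeravainen2019AlmostAllScales §1 fn 3). Imported: the entropy-decrement / logarithmic-averaging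
technology (TaoFMP2016, TaoTeravainen2019Duke,
HelfgottRadziwill2021) as the model in which A is decided, Bombieri's asymptotic sieve indeterminacy
(tree bombieri_asymptotic_sieve_indeterminacy,
FordFixedLevel) as the model family separating B, and an elementary finite Tauberian exchange
(kernel window_core_abs, 40 lines, no Karamata/Schmidt)
for exactness. Versus prior routes: no cell node uses the scale axis (ShiftTauberian averages over
shifts h, DicksonTailEmpty/ShortWindowBridge over
shift windows, ClusterGapCarving over cluster gaps, ConstellationCubes over cube statistics); the
retired TauberianTwins (X6, not-a-thesis) stopped at
PairsHL with a slow-oscillation regularity piece — here the exchange is sited INSIDE the record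
(closes → GHL), for ALL fixed systems with convex bodies,
with B in density-existence form, and with both barrier sides placed.

RANKED CRUXES. #2 LogWindowHL (crux) — Log-window Hardy–Littlewood: for all d, t ≥ 1, every
non-degenerate system Ψ of t affine-linear forms in d variables and every ε > 0 there is N₀ such
that for all N ≥ N₀, all M ≥ N² and every convex K ⊆ [−N,N]^d, |Σ_(N<n≤M) (err Ψ ((n/N)•K) n /
n^d)/n| ≤ ε·Σ_(N<n≤M) 1/n, where err Ψ K' n = vonMangoldtSum Ψ K' n − archFactor Ψ
K'·singularProduct Ψ (the HL asymptotic on logarithmic average over every scale window of log-length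
≥ log N; kernel-necessary from the leaf, from GHL and from BH; NOT for provers — IDEA-NEEDED behind
PrimePairParity (it produces prime pairs); no hypothesis class in print (GRH, EH, GEH) decides this
for Λ short of the leaf; the λ-sibling theorem (log-averaged 2-point Chowla = tree theorem
tao_log_chowla_two_holds) is an ANALOGUE, not a model; credit structural only; barrier INSIDE
(SelbergParity/PrimePairParity); hub prior art: piece (L) of the retired route-Parity-TauberianTwins
X6 — this route is its conforming resurrection; NO prover time — staffable work = HAND-landing the
kernel glue/exactness package and census instruments, zero distance credit). [difficulty:
open-problem] (why it might fail: Kernel-implied by GHL (logWindowHL_of_ghl), so false only with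
Parity; live risk = unprovable: Selberg 1±λ worlds give log-window means ∓𝔖·vol, so no Type-I input
reaches it, and no Λ-analogue of the n ↦ pn entropy-decrement step is known.) [TaoFMP2016,
TaoTeravainen2019AlmostAllScales, arXiv:1509.05422, Bombieri1976,
Literature.Barriers.Parity.LogarithmicAveraging, Literature.Barriers.Parity.PrimePairParity]
#3 ScaleRigidity (crux) — Two-scale rigidity on the matched window (DECLARED RESIDUAL; TERMINAL;
zero credit; never staffed): for all d, t ≥ 1, every non-degenerate Ψ and every ε > 0 there is N₀
such that for all N ≥ N₀, all n with N ≤ n ≤ N² and every convex K ⊆ [−N,N]^d, |err Ψ K N / N^d −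
err Ψ ((n/N)•K) n / n^d| ≤ ε (the normalised signed Hardy–Littlewood error is ε-rigid along every
dilation chain across the window piece A averages over). The R-form of «existence of the density»:
the stronger uniform-Cauchy spelling (all n ≥ N: the limit EXISTS — «proving the mere existence of
the limit captures the difficulty», TT2019 fn 3) implies it and is equivalent to it modulo
LogWindowHL (kernel scaleCauchyAt_iff_scaleRigidityAt_of_logWindow); hub prior art: piece (R) «slow
oscillation» of the retired route-Parity-TauberianTwins X6. Kernel-necessary from the leaf/GHL/BH;
parity-consistent (constant-δ Bombieri worlds and ω-reweighted worlds satisfy it) but not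
sieve-derivable (scale-varying-δ worlds violate it); the matched-window shadow of the
LogarithmicAveraging barrier's proved-evasion class (HasLogMeanValue.eq_of_hasMeanValue). [deps:
LogWindowHL] [difficulty: open-problem] (why it might fail: Kernel-implied by GHL
(scaleRigidity_of_ghl); as a target it forbids π_Ψ drifting between scales N and N² — Bombieri's
asymptotic-sieve indeterminacy shows Type-I data cannot exclude scale-dependent δ(N), so no sieve
input reaches it.) [TaoTeravainen2019AlmostAllScales, Bombieri1976, FordFixedLevel,
Literature.Barriers.Parity.LogarithmicAveraging, Literature.Barriers.Parity.SelbergParity]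
#4 UniformLowerGivenFixed (crux) — the record's item stmt-Parity-26864 verbatim (Q → FixedLower →
the uniform lower half of GHL); shared by signature, filing fields = the record's. [difficulty:
open-problem] (why it might fail: It contains binary Goldbach with the Hardy–Littlewood main term
for every large even N, given Q and the tuples: no method controls an individual shift h ≍ N;
almost-all-h results (MRT 2019, window N^(8/33)) are the ceiling.) [GreenTao2010,
HardyLittlewood1923, MatomakiRadziwillTao2019, MatomakiMerikoski2023,
Literature.Barriers.Parity.CircleMethodBinary]
#5 UniformUpperGivenFixed (crux) — the record's item stmt-Parity-26853 verbatim (Q → FixedUpper →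
the uniform upper half of GHL); shared by signature, filing fields = the record's. [difficulty:
open-problem] (why it might fail: It is the uniform-in-shift (binary Goldbach-type) upper bound with
factor 1+ε given Q and all tuples: pointwise-in-h control beyond windows N^(8/33) (MRT 2019) is
open; the circle method misses binary minor arcs by log x.) [GreenTao2010, MatomakiRadziwillTao2019,
MatomakiMerikoski2023, Literature.Barriers.Parity.TrueComplexityBinary,
Literature.Barriers.Parity.CircleMethodBinary]
#6 BoundedSiegelZeroQuality (crux) — the record's Siegel crux stmt-Parity-25148 verbatim
(exceptional zeros have bounded quality η); shared by signature, filing fields = the record's.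
[difficulty: open-problem] (why it might fail: it is the Landau–Siegel problem: no unconditional
bound on η is known (Siegel's theorem is ineffective); a genuine open problem, not a lemma.)
[HeathBrown1983PrimeTwins, MatomakiMerikoski2023, TaoTeravainen2021]
#9 UpperGlue (support) — LogWindowHL → ScaleRigidity → FixedUpper (the record's stmt-Parity-26852
text verbatim behind the two new hypotheses): the finite Tauberian exchange, upper side. CLOSED by
the cell kernel (upperGlue_holds = fixedUpper_of_pieces via window_core_abs ∘ fixedAt_of_pieces,
which evaluates B only at n ∈ (N, N²]); HAND lands it under Theorems/. [deps: LogWindowHL,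
ScaleRigidity] [difficulty: provable-now] (why it might fail: It cannot: proved in the cell kernel
(ScaleTauberianCarving.upperGlue_holds, rc 0, 0 sorry); the only risk is a transcription slip
between the kernel's expanded signature and the gate render (guarded by Iff.rfl folds).)
[GreenTao2010, TaoFMP2016]
#10 LowerGlue (support) — LogWindowHL → ScaleRigidity → FixedLower (the record's stmt-Parity-26863
text verbatim behind the two new hypotheses): the finite Tauberian exchange, lower side. CLOSED by
the cell kernel (lowerGlue_holds); HAND lands it under Theorems/. [deps: LogWindowHL, ScaleRigidity]
[difficulty: provable-now] (why it might fail: It cannot: proved in the cell kernel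
(ScaleTauberianCarving.lowerGlue_holds, rc 0, 0 sorry); transcription risk only.) [GreenTao2010,
TaoFMP2016]

TWO-LAYER PLAN. None at open. LogWindowHL is never split by window length or by pattern at route
level (every such cut is either a costume of the leaf —
natural-density-one good scales plus sieve Brun–Titchmarsh,
LogarithmicAveragingScope.hasMeanValue_of_goodScale_nearby shape — or the same crux);
ScaleRigidity is a residual and is never split. If LogWindowHL lands, ScaleRigidity ≡ FixedUpper ∧
FixedLower (costume) and the route is superseded by the
record on the fixed leaves (declared).

KILL CRITERIA. A refutation of LogWindowHL or of ScaleRigidity refutes FixedUpper ∧ FixedLower, GHL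
and BH (kernel necessity): route, sub-problem and summit close
refuted together. A landed unconditional proof of LogWindowHL collapses the route onto the record
(ScaleRigidity becomes the leaf: superseded, declared).
A tribunal/critic finding that model separation (Hall worlds / δ-worlds) does not count as «strictly
weaker» leaves the route as a structural
alternative with zero distance credit (declared at birth). A proof that FixedUpper ∧ FixedLower does
NOT imply either piece is impossible (kernel).

NOT DECOMPOSED YET. LogWindowHL is not decomposed into «log-Chowla-type multiplicative input» ∧
«transfer to Λ» (the second would be the whole crux: no Λ-analogue of the
entropy-decrement dilation step n ↦ pn exists — TaoFMP2016 §1 p.4). The almost-all-scales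
strengthening (TaoTeravainen2019AlmostAllScales shape: HL
at log-density-one scales) is NOT filed: for Λ it is not known either, and paired with the matching
B it slides toward the costume end of the
exchange-rate family. No d = 1 / pair-only face is filed separately (the record's G2 ShiftTauberian
and lens-4's PairHL already own the pair faces). The δ-flexible R-form (∀ε ∃δ>0: rigidity only on
[N, N^(1+δ)], X6's (R) verbatim) is weaker still and exact with A at loss (1+δ)/δ (difference of two
A-windows re-based at ⌊√N⌋); it is NOT typed (rpow windows + harmonic-sum comparison ≈ 150 kernel
lines) — a VARIANT spelling of this item, never a second node.

CHEAPEST FALSIFIER. (i) Theorem test (T8): is LogWindowHL already a theorem for Λ? No —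
log-averaging is proved for bounded multiplicative functions (Tao 2016; Tao–
Teräväinen; Helfgott–Radziwiłł) and is explicitly recorded as having «no bearing as yet on twin
prime-type sums» [corpus paper:arxiv-1509.05422 p.4];
lean search finds no LogWindowHL-shape theorem for vonMangoldtSum. (ii) Costume test: does
ScaleRigidity follow from sieve bounds (Brun–Titchmarsh gives
boundedness and bounded-ratio near-constancy of err/N^d, NOT convergence — Bombieri δ(N)-worlds)?
No. (iii) Vacuity: Ioc N M is non-empty for M ≥ N² >
N ≥ 2, the weights 1/n are positive, realBox-dilates stay in realBox (kernel dil_subset_realBox) —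
neither piece is provable by a trivial witness (both
imply the leaf jointly, and the leaf implies twin primes). (iv) C → S probes: neither piece gives
GHL cheaply (BC2/BC7 P5).

NUMBERS. Exchange constant: |a| ≤ 3ε from a window (N, N²] whose log-mean is ≤ ε and whose terms are
ε-close to a (kernel window_core_abs). Window: M ≥ N²,
i.e. log-length ≥ log N (any fixed exponent 1+δ would do; 2 is typed). Sibling theorems: Σ_(n≤x)
λ(n)λ(n+h)/n = o(log x) (Tao 2016, tree
tao_log_chowla_two_holds); almost-all-scales Chowla(2) (Tao–Teräväinen 2019). Λ-side: nothing beyond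
sieve upper bounds (twin constant ≤ 3.2996·2C₂,
Wu 2004) at ANY averaging in N; Bombieri 1976: Type-I data of level < 1 is consistent with δ𝔖 for
every δ ∈ [0,2].

DEFINITION REQUESTS. None: every item is stated over existing declarations
(Literature.NumberTheory.Sieve.{AffLinForm, IsNondegenerateSystem, affLinSize, realBox,
vonMangoldtSum, archFactor, singularProduct}, Literature.Barriers.Parity.IsSiegelZero,
DirichletCharacter, Finset.Ioc, Set.image, Pi scalar action).

Novelty: Searches (2026-08-30): lean search / rg over lean/ for
'logMean|HasLogMeanValue|cesaroMean|Tauberian|log_chowla' (tree: the LogarithmicAveraging barrier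
files, TaoLogElliott facts, retired Theses/TauberianTwins.lean only); ledger negatives --problem
Parity (5 entries, none on the scale axis); the cell bus/TREE v4.19 (no node on the scale axis;
lens-3 g4 TRANSLATION-CENSUS B4 «BARRIER; not a lens-3 node»; lens-2 g5 (c) «resurrect-lens only»);
lit search --hybrid "logarithmically averaged Hardy-Littlewood conjecture von Mangoldt correlations
fixed shift" ([corpus:paper:arxiv-1509.05422 pp.1,3,4], [corpus:paper:arxiv-2109.06291 p.1],
[corpus:paper:arxiv-2111.08912 pp.1,3,16]); lit vsearch "twin prime counting function has an
asymptotic density without determining its value" (generic textbook hits only: bateman2004 p.251,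
crandall1999 p.57); lit galaxy search "logarithmically averaged Hardy|log-averaged Hardy|averaged
Hardy-Littlewood" --star pdf (no hits); lit galaxy search "twin prime constant|Tauberian" --star
panama --title-contains sieve ([galaxy:panama:513317311348797] Cojocaru–Murty, generic).
Nearest prior art found: TaoFMP2016 (arXiv:1509.05422) Thm 1.2 / §1 p.4 (log-averaged Chowla(2);
explicitly no bearing yet on twin-prime sums); TaoTeravainen2019AlmostAllScales §1 fn 3 (existence
of the limit is the difficulty); on the hub the retired route TauberianTwins (X6, rev 1
cc909daf55e7, closed not-a-thesis 2026-08-15: pairs only, pieces (L) log-HL + (R) slow oscillation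
on  [refs: 1509.05422, paper:arxiv-1509.05422, paper:arxiv-2109.06291, paper:arxiv-2111.08912, TaoFMP2016]

Barriers (technique_class: decomposition, tauberian, log-averaging): - technique_class: decomposition, tauberian, log-averaging
- Literature.Barriers.Parity.LogarithmicAveraging: LogWindowHL is INSIDE the barrier's averaged
class BY DESIGN (it is the log statement; the barrier says it does not give the leaf alone — exactly
why ScaleRigidity is load-bearing); ScaleRigidity is by construction the barrier's proved-evasion
hypothesis (HasMeanValue-shape: the limit exists), OUTSIDE the class the barrier quantifies over
(Hall-type sequences have no mean value); the pair (A,B) discharges the barrier through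
HasLogMeanValue.eq_of_hasMeanValue-shape logic (kernel window_core_abs).
- Literature.Barriers.Parity.SelbergParityBarrier: LogWindowHL is INSIDE head-on as a target
(Selberg's 1 ± λ extremal worlds have log-window means ∓𝔖·vol: no Type-I lower/upper bound
information at any scale-averaging reaches it) — declared IDEA-NEEDED+BARRIER, no prover time;
ScaleRigidity is CONSISTENT with both extremal worlds (density 0 and 2𝔖 both exist) hence not
refutable by the parity mechanism, but equally not derivable (residual).
- Literature.Barriers.Parity.PrimePairParity: LogWindowHL INSIDE (it yields infinitely many prime
pairs for every admissible pair system by positivity of 𝔖·vol on log average); ScaleRigidity outside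
the refutation mechanism (ω-reweighted worlds satisfy it) — residual.
- Literature.Barriers.Parity.FordMaynardMinimalTypeII: LogWindowHL inside (detects primes in the
shifted-prime sequence on average over scales; Type I/II content undiminishe

History (route lifecycle, newest last):
- 2026-09-04T15:40:16Z · DORMANT — reconciler: no traction for 5 d (last activity statement-checked at 2026-08-30T14:16:36Z); parked, not closed — `ledger route dormant route-Parity-ScaleTauberia (operator:999:3216997)

sub-problem: GeneralizedHardyLittlewood · status: dormant · opened planner-decomp-parity-lens-6-g6-0 2026-08-30T08:50:36Z · rev 0 · ledger route-Parity-ScaleTauberianCarving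
GENERATED by the gate from the ledger (D-0016/17). Provers cite these decls: `theorem foo : Summit.Parity.GeneralizedHardyLittlewood.Theses.ScaleTauberianCarving.<Decl> := …` in Summits/Parity/GeneralizedHardyLittlewood/Theorems/<Name>.lean.
-/

namespace Summit.Parity.GeneralizedHardyLittlewood.Theses.ScaleTauberianCarving

open scoped BigOperators Topology Manifold Classical MeasureTheory ProbabilityTheory Matrix InnerProductSpace ComplexConjugate ContinuousMap
open Filter Set Function TopologicalSpace MeasureTheory

attribute [summit_statement] _root_.GeneralizedHardyLittlewood

/-- item stmt-Parity-31399 · crux · rank 2 · open · by planner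
why it might fail: Kernel-implied by GHL (logWindowHL_of_ghl), so false only with Parity; live risk = unprovable: Selberg 1±λ worlds give log-window means ∓𝔖·vol, so no Type-I input reaches it, and no Λ-analogue of the n ↦ pn entropy-decrement step is known.
sources: TaoFMP2016, TaoTeravainen2019AlmostAllScales, arXiv:1509.05422, Bombieri1976, Literature.Barriers.Parity.LogarithmicAveraging, Literature.Barriers.Parity.PrimePairParity
[crux] Log-window Hardy–Littlewood: for all d, t ≥ 1, every non-degenerate system Ψ of t
affine-linear forms in d variables and every ε > 0 there is N₀ such that for all N ≥ N₀, all M ≥ N²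
and every convex K ⊆ [−N,N]^d, |Σ_(N<n≤M) (err Ψ ((n/N)•K) n / n^d)/n| ≤ ε·Σ_(N<n≤M) 1/n, where err
Ψ K' n = vonMangoldtSum Ψ K' n − archFactor Ψ K'·singularProduct Ψ (the HL asymptotic on logarithmic
average over every scale window of log-length ≥ log N; kernel-necessary from the leaf, from GHL and
from BH; NOT for provers — IDEA-NEEDED behind PrimePairParity (it produces prime pairs); no
hypothesis class in print (GRH, EH, GEH) decides this for Λ short of the leaf; the λ-sibling theorem
(log-averaged 2-point Chowla = tree theorem tao_log_chowla_two_holds) is an ANALOGUE, not a model;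
credit structural only; barrier INSIDE (SelbergParity/PrimePairParity); hub prior art: piece (L) of
the retired route-Parity-TauberianTwins X6 — this route is its conforming resurrection; NO prover
time — staffable work = HAND-landing the kernel glue/exactness package and census instruments, zero
distance credit). [difficulty: open-problem] -/
@[route_item "route-Parity-ScaleTauberianCarving"]
def LogWindowHL : Prop :=
  ∀ (d t : ℕ), 1 ≤ d → 1 ≤ t → ∀ Ψ : Fin t → Literature.NumberTheory.Sieve.AffLinForm d, Literature.NumberTheory.Sieve.IsNondegenerateSystem Ψ → ∀ ε : ℝ, 0 < ε → ∃ N₀ : ℕ, ∀ N : ℕ, N₀ ≤ N → ∀ M : ℕ, N ^ 2 ≤ M → ∀ K : Set (Fin d → ℝ), Convex ℝ K → K ⊆ Literature.NumberTheory.Sieve.realBox d N → |∑ n ∈ Finset.Ioc N M, (Literature.NumberTheory.Sieve.vonMangoldtSum Ψ ((fun x : Fin d → ℝ => ((n : ℝ) / (N : ℝ)) • x) '' K) n - Literature.NumberTheory.Sieve.archFactor Ψ ((fun x : Fin d → ℝ => ((n : ℝ) / (N : ℝ)) • x) '' K) * Literature.NumberTheory.Sieve.singularProduct Ψ) / (n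 : ℝ) ^ d / n| ≤ ε * ∑ n ∈ Finset.Ioc N M, (1 : ℝ) / n

/-- item stmt-Parity-31400 · crux · rank 3 · open · by planner
why it might fail: Kernel-implied by GHL (scaleRigidity_of_ghl); as a target it forbids π_Ψ drifting between scales N and N² — Bombieri's asymptotic-sieve indeterminacy shows Type-I data cannot exclude scale-dependent δ(N), so no sieve input reaches it.
sources: TaoTeravainen2019AlmostAllScales, Bombieri1976, FordFixedLevel, Literature.Barriers.Parity.LogarithmicAveraging, Literature.Barriers.Parity.SelbergParity
[crux] Two-scale rigidity on the matched window (DECLARED RESIDUAL; TERMINAL; zero credit; never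
staffed): for all d, t ≥ 1, every non-degenerate Ψ and every ε > 0 there is N₀ such that for all N ≥
N₀, all n with N ≤ n ≤ N² and every convex K ⊆ [−N,N]^d, |err Ψ K N / N^d − err Ψ ((n/N)•K) n / n^d|
≤ ε (the normalised signed Hardy–Littlewood error is ε-rigid along every dilation chain across the
window piece A averages over). The R-form of «existence of the density»: the stronger uniform-Cauchy
spelling (all n ≥ N: the limit EXISTS — «proving the mere existence of the limit captures the
difficulty», TT2019 fn 3) implies it and is equivalent to it modulo LogWindowHL (kernel
scaleCauchyAt_iff_scaleRigidityAt_of_logWindow); hub prior art: piece (R) «slow oscillation» of the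
retired route-Parity-TauberianTwins X6. Kernel-necessary from the leaf/GHL/BH; parity-consistent
(constant-δ Bombieri worlds and ω-reweighted worlds satisfy it) but not sieve-derivable
(scale-varying-δ worlds violate it); the matched-window shadow of the LogarithmicAveraging barrier's
proved-evasion class (HasLogMeanValue.eq_of_hasMeanValue). [deps: LogWindowHL] [difficulty:
open-problem] -/
@[route_item "route-Parity-ScaleTauberianCarving"]
def ScaleRigidity : Prop :=
  ∀ (d t : ℕ), 1 ≤ d → 1 ≤ t → ∀ Ψ : Fin t → Literature.NumberTheory.Sieve.AffLinForm d, Literature.NumberTheory.Sieve.IsNondegenerateSystem Ψ → ∀ ε : ℝ, 0 < ε → ∃ N₀ : ℕ, ∀ N : ℕ, N₀ ≤ N → ∀ n : ℕ, N ≤ n → n ≤ N ^ 2 → ∀ K : Set (Fin d → ℝ), Convex ℝ K → K ⊆ Literature.NumberTheory.Sieve.realBox d N → |(Literature.NumberTheory.Sieve.vonMangoldtSum Ψ K N - Literature.NumberTheory.Sieve.archFactor Ψ K * Literature.NumberTheory.Sieve.singularProduct Ψ) / (N : ℝ) ^ d - (Literature.NumberTheory.Sieve.vonMangoldtSum Ψ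 ((fun x : Fin d → ℝ => ((n : ℝ) / (N : ℝ)) • x) '' K) n - Literature.NumberTheory.Sieve.archFactor Ψ ((fun x : Fin d → ℝ => ((n : ℝ) / (N : ℝ)) • x) '' K) * Literature.NumberTheory.Sieve.singularProduct Ψ) / (n : ℝ) ^ d| ≤ ε

/-- item stmt-Parity-26864 · crux · rank 4 · open · by planner
why it might fail: It contains binary Goldbach with the Hardy–Littlewood main term for every large even N, given Q and the tuples: no method controls an individual shift h ≍ N; almost-all-h results (MRT 2019, window N^(8/33)) are the ceiling.
sources: GreenTao2010, HardyLittlewood1923, MatomakiRadziwillTao2019, MatomakiMerikoski2023, Literature.Barriers.Parity.CircleMethodBinary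
[crux · DECLARED-RESIDUAL; node TupleUniformitySplit (lens-5 g3): shift-uniformity of the lower half
GIVEN bounded Siegel quality and the fixed-pattern lower half] Q → FixedLower → (uniform lower half
of GHL). Exactly the binary content of LQ — binary Goldbach for all large even N with the HL main
term, and all moving-shift lower bounds — with the tuples split off: kernel
lowerGivenBoundedSiegel_iff : LQ ↔ (Q → FixedLower) ∧ this; WEAKER than LQ (world ¬(Q →
FixedLower)); FixedLower hypothesis load-bearing (T6). INSTRUMENTABLE: kernel
windowLower_of_fixedLower gives all shift windows ≫ εN from FixedLower_{d+1}; this item is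
WINDOW(δN) → POINT; notch ladder = rungs (T11). -/
@[route_item "route-Parity-ScaleTauberianCarving"]
def UniformLowerGivenFixed : Prop :=
  (∃ η₀ : ℝ, ∃ q₀ : ℕ, ∀ (q : ℕ) [NeZero q] (χ : DirichletCharacter ℂ q) (η : ℝ), q₀ ≤ q → Literature.Barriers.Parity.IsSiegelZero χ η → η < η₀) → (∀ (d t : ℕ), 1 ≤ d → 1 ≤ t → ∀ Ψ : Fin t → Literature.NumberTheory.Sieve.AffLinForm d, Literature.NumberTheory.Sieve.IsNondegenerateSystem Ψ → ∀ ε : ℝ, 0 < ε → ∃ N₀ : ℕ, ∀ N : ℕ, N₀ ≤ N → ∀ K : Set (Fin d → ℝ), Convex ℝ K → K ⊆ Literature.NumberTheory.Sieve.realBox d N → Literature.NumberTheory.Sieve.archFactor Ψ K * Literature.NumberTheory.Sieve.singularProduct Ψ - Literature.NumberTheory.Sieve.vonMangoldtSum Ψ K N ≤ ε * (N : ℝ) ^ d) → ∀ (d t L : ℕ), 1 ≤ d → 1 ≤ t → ∀ ε : ℝ, 0 < ε → ∃ N₀ : ℕ, ∀ N : ℕ, N₀ ≤ N → ∀ Ψ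 : Fin t → Literature.NumberTheory.Sieve.AffLinForm d, Literature.NumberTheory.Sieve.IsNondegenerateSystem Ψ → Literature.NumberTheory.Sieve.affLinSize Ψ N ≤ L → ∀ K : Set (Fin d → ℝ), Convex ℝ K → K ⊆ Literature.NumberTheory.Sieve.realBox d N → Literature.NumberTheory.Sieve.archFactor Ψ K * Literature.NumberTheory.Sieve.singularProduct Ψ - Literature.NumberTheory.Sieve.vonMangoldtSum Ψ K N ≤ ε * (N : ℝ) ^ d

/-- item stmt-Parity-26853 · crux · rank 5 · open · by planner
why it might fail: It is the uniform-in-shift (binary Goldbach-type) upper bound with factor 1+ε given Q and all tuples: pointwise-in-h control beyond windows N^(8/33) (MRT 2019) is open; the circle method misses binary minor arcs by log x.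
sources: GreenTao2010, MatomakiRadziwillTao2019, MatomakiMerikoski2023, Literature.Barriers.Parity.TrueComplexityBinary, Literature.Barriers.Parity.CircleMethodBinary
[crux · DECLARED-RESIDUAL; node TupleUniformitySplit (lens-5 g3): shift-uniformity of the upper half
GIVEN bounded Siegel quality and the fixed-pattern upper half] Q → FixedUpper → (uniform upper half
of GHL: one N₀(d,t,L,ε) for all Ψ with ‖Ψ‖_N ≤ L). Exactly the binary / moving-target content of UQ
(Goldbach-type systems (n, N−n), shifts h ≍ N) with the tuple content split off: kernel
upperGivenBoundedSiegel_iff : UQ ↔ (Q → FixedUpper) ∧ this, so WEAKER than UQ (separating world ¬(Q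
→ FixedUpper)) and the FixedUpper hypothesis is load-bearing (T6). Transpose of the PairsToGHL cut
(9389: pairs-uniform base, tuples residual). INSTRUMENTABLE: kernel windowUpper_of_fixedUpper —
FixedUpper in dimension d+1 already gives every shift-WINDOW average of length ≫ εN; this item is
WINDOW(δN) → POINT; notches N^{8/33} (MRT) → N^{7/30} (ShiftTauberian) → polylog are rungs (T11),
not filed. -/
@[route_item "route-Parity-ScaleTauberianCarving"]
def UniformUpperGivenFixed : Prop :=
  (∃ η₀ : ℝ, ∃ q₀ : ℕ, ∀ (q : ℕ) [NeZero q] (χ : DirichletCharacter ℂ q) (η : ℝ), q₀ ≤ q → Literature.Barriers.Parity.IsSiegelZero χ η → η < η₀) → (∀ (d t : ℕ), 1 ≤ d → 1 ≤ t → ∀ Ψ : Fin t → Literature.NumberTheory.Sieve.AffLinForm d, Literature.NumberTheory.Sieve.IsNondegenerateSystem Ψ → ∀ ε : ℝ, 0 < ε → ∃ N₀ : ℕ, ∀ N : ℕ, N₀ ≤ N → ∀ K : Set (Fin d → ℝ), Convex ℝ K → K ⊆ Literature.NumberTheory.Sieve.realBox d N → Literature.NumberTheory.Sieve.vonMangoldtSum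 Ψ K N - Literature.NumberTheory.Sieve.archFactor Ψ K * Literature.NumberTheory.Sieve.singularProduct Ψ ≤ ε * (N : ℝ) ^ d) → ∀ (d t L : ℕ), 1 ≤ d → 1 ≤ t → ∀ ε : ℝ, 0 < ε → ∃ N₀ : ℕ, ∀ N : ℕ, N₀ ≤ N → ∀ Ψ : Fin t → Literature.NumberTheory.Sieve.AffLinForm d, Literature.NumberTheory.Sieve.IsNondegenerateSystem Ψ → Literature.NumberTheory.Sieve.affLinSize Ψ N ≤ L → ∀ K : Set (Fin d → ℝ), Convex ℝ K → K ⊆ Literature.NumberTheory.Sieve.realBox d N → Literature.NumberTheory.Sieve.vonMangoldtSum Ψ K N - Literature.NumberTheory.Sieve.archFactor Ψ K * Literature.NumberTheory.Sieve.singularProduct Ψ ≤ ε * (N : ℝ) ^ d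

/-- item stmt-Parity-25148 · crux · rank 6 · open · by planner
why it might fail: it is the Landau–Siegel problem: no unconditional bound on η is known (Siegel's theorem is ineffective); a genuine open problem, not a lemma.
sources: HeathBrown1983PrimeTwins, MatomakiMerikoski2023, TaoTeravainen2021
[crux] Siegel zeros of primitive quadratic characters have bounded quality at all large conductors:
∃ η₀ q₀, every Siegel zero (IsSiegelZero χ η) of conductor q ≥ q₀ has η < η₀ — literally
¬UnboundedSiegelZeros (Landau–Siegel in the form the MM bridge needs). [difficulty: open-problem] ‖
TAG [crit-1 CLEARED 2026-08-30T01:46:27Z, HOME/STATUS.md l.26]: WEAKER (kernel mod MM2023 print; Q ⟹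
GHL unknown); leaf IDEA-NEEDED (Landau–Siegel) + ATTACKABLE-rung (Zhang2022 skeleton routes
PrimeLevelFamEdge/ZDegreeToeplitzBand; lens-2 T_ω ladder) + INSTRUMENTABLE (finite conductor tables,
not a rung). BC3 birth skeleton: stub_weakGoldbach (WeakHLGoldbachConj ½, open) → stub_exclusion
(MM2023 Cor 1.2 Goldbach detector + |L'| ≪ log²q, provable-now) → Q. Census
HOME/census/COSTUME-CENSUS-v1.md sha256
4afbbbc68c038369818dcc2bcc5990569ac50a4757d8938468c0838377ddd628 row WK8. -/
@[route_item "route-Parity-ScaleTauberianCarving"]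
def BoundedSiegelZeroQuality : Prop :=
  ∃ η₀ : ℝ, ∃ q₀ : ℕ, ∀ (q : ℕ) [NeZero q] (χ : DirichletCharacter ℂ q) (η : ℝ), q₀ ≤ q → Literature.Barriers.Parity.IsSiegelZero χ η → η < η₀

/-- item stmt-Parity-31401 · support · rank 9 · closed · proved by Summit.Parity.GeneralizedHardyLittlewood.Theses.ScaleTauberianCarving.upperGlue_holds (prover) · by planner
why it might fail: It cannot: proved in the cell kernel (ScaleTauberianCarving.upperGlue_holds, rc 0, 0 sorry); the only risk is a transcription slip between the kernel's expanded signature and the gate render (guarded by Iff.rfl folds).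
sources: GreenTao2010, TaoFMP2016
[support] LogWindowHL → ScaleRigidity → FixedUpper (the record's stmt-Parity-26852 text verbatim
behind the two new hypotheses): the finite Tauberian exchange, upper side. CLOSED by the cell kernel
(upperGlue_holds = fixedUpper_of_pieces via window_core_abs ∘ fixedAt_of_pieces, which evaluates B
only at n ∈ (N, N²]); HAND lands it under Theorems/. [deps: LogWindowHL, ScaleRigidity] [difficulty:
provable-now] -/
@[route_item "route-Parity-ScaleTauberianCarving"]
def UpperGlue : Prop :=
  LogWindowHL → ScaleRigidity → ∀ (d t : ℕ), 1 ≤ d → 1 ≤ t → ∀ Ψ : Fin t → Literature.NumberTheory.Sieve.AffLinForm d, Literature.NumberTheory.Sieve.IsNondegenerateSystem Ψ → ∀ ε : ℝ, 0 < ε → ∃ N₀ : ℕ, ∀ N : ℕ, N₀ ≤ N → ∀ K : Set (Fin d → ℝ), Convex ℝ K → K ⊆ Literature.NumberTheory.Sieve.realBox d N → Literature.NumberTheory.Sieve.vonMangoldtSum Ψ K N - Literature.NumberTheory.Sieve.archFactor Ψ K * Literature.NumberTheory.Sieve.singularProduct Ψ ≤ ε * (N : ℝ) ^ d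

-- `UpperGlue` holds: proved by `Summit.Parity.GeneralizedHardyLittlewood.Theses.ScaleTauberianCarving.upperGlue_holds` (its module imports this route file, so no `_holds` link can be stated here).

/-- item stmt-Parity-31402 · support · rank 10 · closed · proved by Summit.Parity.GeneralizedHardyLittlewood.Theses.ScaleTauberianCarving.lowerGlue_holds (prover) · by planner
why it might fail: It cannot: proved in the cell kernel (ScaleTauberianCarving.lowerGlue_holds, rc 0, 0 sorry); transcription risk only.
sources: GreenTao2010, TaoFMP2016
[support] LogWindowHL → ScaleRigidity → FixedLower (the record's stmt-Parity-26863 text verbatim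
behind the two new hypotheses): the finite Tauberian exchange, lower side. CLOSED by the cell kernel
(lowerGlue_holds); HAND lands it under Theorems/. [deps: LogWindowHL, ScaleRigidity] [difficulty:
provable-now] -/
@[route_item "route-Parity-ScaleTauberianCarving"]
def LowerGlue : Prop :=
  LogWindowHL → ScaleRigidity → ∀ (d t : ℕ), 1 ≤ d → 1 ≤ t → ∀ Ψ : Fin t → Literature.NumberTheory.Sieve.AffLinForm d, Literature.NumberTheory.Sieve.IsNondegenerateSystem Ψ → ∀ ε : ℝ, 0 < ε → ∃ N₀ : ℕ, ∀ N : ℕ, N₀ ≤ N → ∀ K : Set (Fin d → ℝ), Convex ℝ K → K ⊆ Literature.NumberTheory.Sieve.realBox d N → Literature.NumberTheory.Sieve.archFactor Ψ K * Literature.NumberTheory.Sieve.singularProduct Ψ - Literature.NumberTheory.Sieve.vonMangoldtSum Ψ K N ≤ ε * (N : ℝ) ^ d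

-- `LowerGlue` holds: proved by `Summit.Parity.GeneralizedHardyLittlewood.Theses.ScaleTauberianCarving.lowerGlue_holds` (its module imports this route file, so no `_holds` link can be stated here).

/-- item stmt-Parity-31403 · assembly · rank 1 · closed · proved by Summit.Parity.GeneralizedHardyLittlewood.Theses.ScaleTauberianCarving.assembly_proof (prover) · by planner
sources: GreenTao2010, TaoFMP2016
[assembly] BoundedSiegelZeroQuality → UniformUpperGivenFixed → UniformLowerGivenFixed → LogWindowHL
→ ScaleRigidity → UpperGlue → LowerGlue → GeneralizedHardyLittlewood -/
@[route_item "route-Parity-ScaleTauberianCarving"]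
def Assembly : Prop :=
  BoundedSiegelZeroQuality → UniformUpperGivenFixed → UniformLowerGivenFixed → LogWindowHL → ScaleRigidity → UpperGlue → LowerGlue → GeneralizedHardyLittlewood

-- `Assembly` holds: proved by `Summit.Parity.GeneralizedHardyLittlewood.Theses.ScaleTauberianCarving.assembly_proof` (its module imports this route file, so no `_holds` link can be stated here).

/-! D-0027 §2.1 — DECIDING THEOREM (planner-authored via `route open/edit --closes-file`; by planner-decomp-parity-lens-6-g6-0 2026-08-30T08:50:37Z):
its hypotheses are this route's items and its conclusion the sub-problem Statement (glue_lint), and it elaborates with this file. -/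

@[closes "route-Parity-ScaleTauberianCarving"] theorem closes (hQ : BoundedSiegelZeroQuality) (hUU : UniformUpperGivenFixed) (hUL : UniformLowerGivenFixed)
    (hA : LogWindowHL) (hB : ScaleRigidity) (hGU : UpperGlue) (hGL : LowerGlue) : GeneralizedHardyLittlewood := by
  intro d t L hd ht ε hε
  obtain ⟨N₁, h₁⟩ := hUU hQ (hGU hA hB) d t L hd ht ε hε
  obtain ⟨N₂, h₂⟩ := hUL hQ (hGL hA hB) d t L hd ht ε hε
  refine ⟨max N₁ N₂, fun N hN Ψ hΨ hΨL K hK hKN => abs_sub_le_iff.mpr ⟨?_, ?_⟩⟩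
  · exact h₁ N (le_trans (le_max_left _ _) hN) Ψ hΨ hΨL K hK hKN
  · exact h₂ N (le_trans (le_max_right _ _) hN) Ψ hΨ hΨL K hK hKN

end Summit.Parity.GeneralizedHardyLittlewood.Theses.ScaleTauberianCarving
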